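import Literature.NumberTheory.Automorphic.GaloisActionPlaces
import Literature.NumberTheory.Automorphic.IdeleNormTowerProofs
import Mathlib.NumberTheory.NumberField.InfinitePlace.Ramification
import Mathlib.FieldTheory.Galois.Basic
import Mathlib.GroupTheory.GroupAction.SubMulAction
import HarnessLib

/-!
# Places above `S` as a `Gal(E/F)`-set and the orbits of a subgroup: `#(S_E/H) = #S_{E^H}`,
# `#(S_∞(E)/H) = #S_∞(E^H)`

Topic `NumberTheory/NumberFields`; namespace `Literature.NumberTheory.NumberFields.EquivariantSUnit`.
ONE definition with body (`placesAbove`, a `SubMulAction`; no instance, no notation) and theorems;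
no named fact, no `sorry`.  First half of the equivariant `S`-unit theorem (Herbrand; Cassels–Fröhlich
Ch. VII §8.3, Neukirch–Schmidt–Wingberg (8.7.2)) written for lane «TATE-EPC-TC» of cell `bsd-eis`
(crux `GoodLatticeBDPValue`, stmt-BirchSwinnertonDyer-19032; road memo `TATE-EPC-TC-ROAD-w5g7.md`, brick
B7): the COMBINATORIAL side — the permutation `Gal(E/F)`-sets of places and their orbit counts.

Setting: number fields `K ⊆ F ⊆ E` (`IsScalarTower K F E`), `E/F` Galois with group `G = E ≃ₐ[F] E`,
`S` a set of finite places of `K` (`HeightOneSpectrum (𝓞 K)`).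

* §1 **`placesAbove K S F E : SubMulAction (E ≃ₐ[F] E) (HeightOneSpectrum (𝓞 E))`** — the `G`-set
  `S_E = {w | w ∩ 𝓞 K ∈ S}` of places of `E` above `S` (the tree's action
  `Automorphic.instMulActionHeightOneSpectrum`, `under_algEquiv_smul`: conjugate places lie over the same
  place); `finite_setOf_under_mem` / `finite_placesAbove` (finite for finite `S`).
* §2 for a subgroup `H ≤ G` with fixed field `E^H = IntermediateField.fixedField H`:
  `orbitRel_subgroup_eq` — on any `X` carrying compatible actions of `Gal(E/F)` and `Gal(E/E^H)`
  (`σ • x = σ|_F • x`) the `H`-orbits are the `Gal(E/E^H)`-orbits (Galois correspondence, Mathlib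
  `IntermediateField.subgroupEquivAlgEquiv`); **`natCard_orbitRelQuotient_infinitePlace`**
  (`#(S_∞(E)/H) = #S_∞(E^H)`, Mathlib `InfinitePlace.orbitRelEquiv`) and
  **`natCard_orbitRelQuotient_placesAbove`** (`#(S_E/H) = #{u ∈ S_{E^H}}`: the map `w ↦ w ∩ E^H` is
  surjective with fibres the `Gal(E/E^H)`-orbits, tree `HeightOneSpectrum.exists_algEquiv_smul_eq`).

The sequel `EquivariantSUnitRank.lean` supplies the unit side (`(𝒪_{E,S}^×)^H = 𝒪_{E^H,S}^×`,
Dirichlet) and Herbrand's theorem `(ℚ ⊗ 𝒪_{E,S}^×) ⊕ ℚ ≅ ℚ[S_E ⊔ S_∞(E)]`.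

## References
* [CasselsFrohlichANT1967] J. W. S. Cassels, A. Fröhlich (eds.), *Algebraic Number Theory* (1967),
  Ch. VII (Tate) §1.1 (action of `G` on primes), Prop. 1.2 (ii) (transitivity), §8.3 (the lattices
  `N = ℤ^T`, `M = λ(L_T) + ℤg`).
* [NeukirchSchmidtWingberg2008] J. Neukirch, A. Schmidt, K. Wingberg, *Cohomology of Number Fields*,
  2nd ed., (8.7.2) (the `ℚ[G]`-structure of `E_S ⊗ ℚ`).
* [MilneFT2022] J. S. Milne, *Fields and Galois Theory*, Thm. 3.16 (fundamental theorem of Galois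
  theory: `H = Gal(E/E^H)`).
* [NeukirchANT1999] J. Neukirch, *Algebraic Number Theory*, Ch. I (8.2)–(8.3) (finitely many primes
  above a prime).
-/

noncomputable section

open NumberField IsDedekindDomain MulAction
open scoped Pointwise
open Literature.NumberTheory.Automorphic

namespace Literature.NumberTheory.NumberFields

namespace EquivariantSUnit

variable (K : Type) [Field K] [NumberField K] (S : Set (HeightOneSpectrum (𝓞 K)))
variable (F E : Type) [Field F] [NumberField F] [Field E] [NumberField E]
  [Algebra K F] [Algebra K E] [Algebra F E] [IsScalarTower K F E]

/-! ## §1 The `Gal(E/F)`-set `S_E` of places of `E` above `S` -/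

/-- **The places of `E` above `S` as a `Gal(E/F)`-set** (`K ⊆ F ⊆ E`, `S` a set of finite places of
`K`): the sub-`Gal(E/F)`-set `{w | w ∩ 𝓞 K ∈ S}` of the finite places of `E` (conjugate places lie over
the same place).  Its coercion to a type carries Mathlib's `SubMulAction` action.
[cite: CasselsFrohlichANT1967, Ch. VII §1.1 (action of `G` on the primes of `L`)] -/
def placesAbove : SubMulAction (E ≃ₐ[F] E) (HeightOneSpectrum (𝓞 E)) where
  carrier := {w | w.under (𝓞 K) ∈ S}
  smul_mem' σ w hw := by
    change (σ • w).under (𝓞 K) ∈ S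
    rw [← HeightOneSpectrum.under_under K F E (σ • w), HeightOneSpectrum.under_algEquiv_smul F E σ w,
      HeightOneSpectrum.under_under]
    exact hw

variable {K S F E}

omit [NumberField K] in
/-- Membership in `placesAbove`: `w ∩ 𝓞 K ∈ S`. [cite: CasselsFrohlichANT1967, Ch. VII §1.1] -/
theorem mem_placesAbove_iff (w : HeightOneSpectrum (𝓞 E)) :
    w ∈ placesAbove K S F E ↔ w.under (𝓞 K) ∈ S := Iff.rfl

omit [NumberField K] in
/-- `↑(σ • w) = σ • ↑w` on `placesAbove`. [cite: CasselsFrohlichANT1967, Ch. VII §1.1] -/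
theorem coe_smul_placesAbove (σ : E ≃ₐ[F] E) (w : placesAbove K S F E) :
    ((σ • w : placesAbove K S F E) : HeightOneSpectrum (𝓞 E)) = σ • (w : HeightOneSpectrum (𝓞 E)) := rfl

variable (K E) in
/-- **Finitely many places of `E` lie above a finite set of places of `K`** (each place of `K` has
finitely many places of `E` above it, Mathlib `primesOver_finite`). [cite: NeukirchANT1999, Ch. I (8.2)–(8.3)] -/
theorem finite_setOf_under_mem (hS : S.Finite) :
    {w : HeightOneSpectrum (𝓞 E) | w.under (𝓞 K) ∈ S}.Finite := by
  have h : {w : HeightOneSpectrum (𝓞 E) | w.under (𝓞 K) ∈ S} ⊆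
      ⋃ v ∈ S, {w : HeightOneSpectrum (𝓞 E) | w.asIdeal ∈ v.asIdeal.primesOver (𝓞 E)} := by
    intro w hw
    simp only [Set.mem_iUnion, Set.mem_setOf_eq]
    exact ⟨w.under (𝓞 K), hw, w.isPrime, ⟨rfl⟩⟩
  refine Set.Finite.subset (Set.Finite.biUnion hS fun v _ => ?_) h
  have hfin : (v.asIdeal.primesOver (𝓞 E)).Finite :=
    IsDedekindDomain.primesOver_finite v.asIdeal (𝓞 E)
  exact (hfin.preimage fun w _ w' _ hww' => HeightOneSpectrum.ext hww')

/-- `placesAbove K S F E` is finite for finite `S`. [cite: NeukirchANT1999, Ch. I (8.2)–(8.3)] -/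
theorem finite_placesAbove (hS : S.Finite) : Finite (placesAbove K S F E) :=
  (finite_setOf_under_mem K E hS).to_subtype

/-! ## §2 Orbits of a subgroup `H ≤ Gal(E/F)` on places = places of the fixed field `E^H` -/

section Orbits

variable {F E : Type} [Field F] [Field E] [Algebra F E] [FiniteDimensional F E]

/-- For `H ≤ Gal(E/F)` and `σ ∈ Gal(E/E^H)`, the element `σ|_F ∈ H` (Mathlib
`IntermediateField.subgroupEquivAlgEquiv`): `((subgroupEquivAlgEquiv H).symm σ : Gal(E/F)) = σ.restrictScalars F`.
[cite: MilneFT2022, Thm. 3.16 (fundamental theorem of Galois theory)] -/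
theorem coe_subgroupEquivAlgEquiv_symm (H : Subgroup (E ≃ₐ[F] E))
    (σ : E ≃ₐ[IntermediateField.fixedField H] E) :
    ((IntermediateField.subgroupEquivAlgEquiv H).symm σ : E ≃ₐ[F] E) = σ.restrictScalars F := rfl

/-- `(subgroupEquivAlgEquiv H h)|_F = h`. [cite: MilneFT2022, Thm. 3.16 (fundamental theorem of Galois theory)] -/
theorem restrictScalars_subgroupEquivAlgEquiv (H : Subgroup (E ≃ₐ[F] E)) (h : H) :
    (IntermediateField.subgroupEquivAlgEquiv H h).restrictScalars F = (h : E ≃ₐ[F] E) :=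
  AlgEquiv.ext fun _ => rfl

/-- **Orbits of a subgroup are orbits of the Galois group of its fixed field**: if `Gal(E/F)` and
`Gal(E/E^H)` act compatibly on `X` (`σ • x = σ|_F • x`), the orbit relation of `H ≤ Gal(E/F)` on `X` is
that of `Gal(E/E^H)` (Galois correspondence `H = Gal(E/E^H)`, Mathlib `subgroupEquivAlgEquiv`).
[cite: MilneFT2022, Thm. 3.16 (fundamental theorem of Galois theory)] -/
theorem orbitRel_subgroup_eq (H : Subgroup (E ≃ₐ[F] E)) {X : Type*} [MulAction (E ≃ₐ[F] E) X]
    [MulAction (E ≃ₐ[IntermediateField.fixedField H] E) X]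
    (hX : ∀ (σ : E ≃ₐ[IntermediateField.fixedField H] E) (x : X), σ • x = σ.restrictScalars F • x) :
    orbitRel H X = orbitRel (E ≃ₐ[IntermediateField.fixedField H] E) X := by
  refine Setoid.ext fun x y => ?_
  rw [orbitRel_apply, orbitRel_apply, mem_orbit_iff, mem_orbit_iff]
  constructor
  · rintro ⟨h, rfl⟩
    refine ⟨IntermediateField.subgroupEquivAlgEquiv H h, ?_⟩
    rw [hX, restrictScalars_subgroupEquivAlgEquiv]
    rfl
  · rintro ⟨σ, rfl⟩
    refine ⟨(IntermediateField.subgroupEquivAlgEquiv H).symm σ, ?_⟩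
    rw [hX]
    rfl

/-- Hence the same number of orbits. [cite: MilneFT2022, Thm. 3.16 (fundamental theorem of Galois theory)] -/
theorem natCard_orbitRelQuotient_subgroup_eq (H : Subgroup (E ≃ₐ[F] E)) {X : Type*}
    [MulAction (E ≃ₐ[F] E) X] [MulAction (E ≃ₐ[IntermediateField.fixedField H] E) X]
    (hX : ∀ (σ : E ≃ₐ[IntermediateField.fixedField H] E) (x : X), σ • x = σ.restrictScalars F • x) :
    Nat.card (orbitRel.Quotient H X) =
      Nat.card (orbitRel.Quotient (E ≃ₐ[IntermediateField.fixedField H] E) X) :=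
  Nat.card_congr (Quotient.congrRight fun a b => by rw [orbitRel_subgroup_eq H hX])

end Orbits

section Places

variable {F E : Type} [Field F] [NumberField F] [Field E] [NumberField E] [Algebra F E]

omit [NumberField F] [NumberField E] in
/-- The two Galois actions on infinite places are compatible along restriction of scalars
(both are `w ↦ w ∘ σ⁻¹`). [cite: CasselsFrohlichANT1967, Ch. VII §1.1] -/
theorem restrictScalars_smul_infinitePlace {M : IntermediateField F E} (σ : E ≃ₐ[M] E)
    (w : InfinitePlace E) : σ • w = σ.restrictScalars F • w := rfl

omit [NumberField F] [NumberField E] in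
/-- The two Galois actions on finite places are compatible along restriction of scalars
(both are `𝔭 ↦ σ𝔭`). [cite: CasselsFrohlichANT1967, Ch. VII §1.1] -/
theorem restrictScalars_smul_heightOneSpectrum {M : IntermediateField F E} (σ : E ≃ₐ[M] E)
    (w : HeightOneSpectrum (𝓞 E)) : σ • w = σ.restrictScalars F • w := by
  apply HeightOneSpectrum.ext
  change σ • w.asIdeal = σ.restrictScalars F • w.asIdeal
  ext x
  rw [Ideal.mem_pointwise_smul_iff_inv_smul_mem, Ideal.mem_pointwise_smul_iff_inv_smul_mem]
  rfl

variable [IsGalois F E]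

/-- **`#(S_∞(E)/H) = #S_∞(E^H)`**: the `H`-orbits of infinite places of `E` are the infinite places of
the fixed field (Mathlib `InfinitePlace.orbitRelEquiv` for the Galois extension `E/E^H`).
[cite: CasselsFrohlichANT1967, Ch. VII Prop. 1.2 (ii)] -/
theorem natCard_orbitRelQuotient_infinitePlace (H : Subgroup (E ≃ₐ[F] E)) :
    Nat.card (orbitRel.Quotient H (InfinitePlace E)) =
      Fintype.card (InfinitePlace (IntermediateField.fixedField H)) := by
  rw [natCard_orbitRelQuotient_subgroup_eq H (fun σ w => restrictScalars_smul_infinitePlace σ w),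
    ← Nat.card_eq_fintype_card]
  exact Nat.card_congr (InfinitePlace.orbitRelEquiv (k := IntermediateField.fixedField H) (K := E))

variable {K : Type} [Field K] {S : Set (HeightOneSpectrum (𝓞 K))}
  [Algebra K F] [Algebra K E] [IsScalarTower K F E]

/-- The place of `E^H` below a place of `E` above `S`, as a map `S_E → S_{E^H}` (plumbing for the
orbit count). [cite: CasselsFrohlichANT1967, Ch. VII §1.1] -/
def underFixedField (H : Subgroup (E ≃ₐ[F] E)) (w : placesAbove K S F E) :
    {u : HeightOneSpectrum (𝓞 (IntermediateField.fixedField H)) | u.under (𝓞 K) ∈ S} :=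
  ⟨(w : HeightOneSpectrum (𝓞 E)).under (𝓞 (IntermediateField.fixedField H)), by
    haveI : IsScalarTower K (IntermediateField.fixedField H) E :=
      IsScalarTower.of_algebraMap_eq fun _ => rfl
    rw [Set.mem_setOf_eq, HeightOneSpectrum.under_under K (IntermediateField.fixedField H) E]
    exact w.2⟩

omit [IsGalois F E] in
/-- `underFixedField` is surjective: every place of `E^H` has a place of `E` above it.
[cite: CasselsFrohlichANT1967, Ch. VII §1.1] -/
theorem underFixedField_surjective (H : Subgroup (E ≃ₐ[F] E)) :
    Function.Surjective (underFixedField (K := K) (S := S) H) := by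
  rintro ⟨u, hu⟩
  haveI : IsScalarTower K (IntermediateField.fixedField H) E :=
    IsScalarTower.of_algebraMap_eq fun _ => rfl
  haveI := u.isMaximal
  obtain ⟨P, hPm, hP⟩ := Ideal.exists_maximal_ideal_liesOver_of_isIntegral (S := 𝓞 E) u.asIdeal
  have hP0 : P ≠ ⊥ := Ideal.ne_bot_of_liesOver_of_ne_bot u.ne_bot P
  have hw : (⟨P, hPm.isPrime, hP0⟩ : HeightOneSpectrum (𝓞 E)).under
      (𝓞 (IntermediateField.fixedField H)) = u := HeightOneSpectrum.ext hP.over.symm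
  refine ⟨⟨⟨P, hPm.isPrime, hP0⟩, ?_⟩, Subtype.ext hw⟩
  rw [mem_placesAbove_iff, ← HeightOneSpectrum.under_under K (IntermediateField.fixedField H) E, hw]
  exact hu

/-- Two places of `E` above `S` lie over the same place of `E^H` iff they are `H`-conjugate
(transitivity of `Gal(E/E^H)` on the fibres, Mathlib `Ideal.exists_smul_eq_of_isGaloisGroup`).
[cite: CasselsFrohlichANT1967, Ch. VII Prop. 1.2 (ii)] -/
theorem underFixedField_eq_iff (H : Subgroup (E ≃ₐ[F] E)) (w w' : placesAbove K S F E) :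
    underFixedField H w = underFixedField H w' ↔ (orbitRel H (placesAbove K S F E)) w w' := by
  rw [orbitRel_apply, mem_orbit_iff]
  constructor
  · intro h
    have h' := congrArg Subtype.val h
    obtain ⟨σ, hσ⟩ := HeightOneSpectrum.exists_algEquiv_smul_eq (IntermediateField.fixedField H)
      (E := E) (w := (w' : HeightOneSpectrum (𝓞 E))) (w' := (w : HeightOneSpectrum (𝓞 E)))
      (by exact h'.symm)
    refine ⟨(IntermediateField.subgroupEquivAlgEquiv H).symm σ, Subtype.ext ?_⟩
    rw [← hσ, restrictScalars_smul_heightOneSpectrum]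
    rfl
  · rintro ⟨h, rfl⟩
    apply Subtype.ext
    change ((h : E ≃ₐ[F] E) • (w' : HeightOneSpectrum (𝓞 E))).under _ = _
    rw [← restrictScalars_subgroupEquivAlgEquiv H h, ← restrictScalars_smul_heightOneSpectrum]
    exact HeightOneSpectrum.under_algEquiv_smul (IntermediateField.fixedField H) E _ _

/-- **`#(S_E/H) = #S_{E^H}`**: the `H`-orbits of the places of `E` above `S` are the places of the
fixed field `E^H` above `S`. [cite: CasselsFrohlichANT1967, Ch. VII Prop. 1.2 (ii)] -/
theorem natCard_orbitRelQuotient_placesAbove (H : Subgroup (E ≃ₐ[F] E)) :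
    Nat.card (orbitRel.Quotient H (placesAbove K S F E)) =
      Nat.card {u : HeightOneSpectrum (𝓞 (IntermediateField.fixedField H)) | u.under (𝓞 K) ∈ S} := by
  refine Nat.card_congr (Equiv.ofBijective
    (Quotient.lift (underFixedField H) fun a b hab => ((underFixedField_eq_iff H a b).2 hab))
    ⟨?_, ?_⟩)
  · rintro ⟨a⟩ ⟨b⟩ hab
    exact Quotient.sound ((underFixedField_eq_iff H a b).1 hab)
  · intro u
    obtain ⟨w, hw⟩ := underFixedField_surjective H u
    exact ⟨⟦w⟧, hw⟩

end Places

end EquivariantSUnit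

end Literature.NumberTheory.NumberFields

end
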